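import Mathlib
import Summits.MatrixMultiplication.MatrixMultiplication.Theorems.FidelityWitnessesFidelityGapTwoSixExplicitKernel
import Literature.Computability.AlgebraicComplexity.TensorApolarityForms

/-!
# `FidelityGapTwoSixExplicit` — the transpose symmetry of `⟨2,2,2⟩`

Part of the proof of `FidelityWitnesses.FidelityGapTwoSixExplicit` (stmt-MatrixMultiplication-14041); see
`FidelityWitnessesFidelityGapTwoSixExplicitDefs.lean` for the line of argument.  Here: the symmetry
`(X, Y) ↦ (Yᵀ, Xᵀ)` of matrix multiplication on bilinear-form indices (`swapTr`), under which
`T = ⟨2,2,2⟩` is invariant; the transported space `F^σ` has `F^σ·A* ≅ F·B*` (`prodA_sigmaF`), the same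
slice defects and dimension; the symmetry `sigmaV` on `V16` is an involutive isometry preserving
`annT` and transporting `perpTo`; and `⟪u_i ⊗ h, ℓ⟫ = ⟪h, hComp i ℓ⟫`.
-/

noncomputable section

namespace Summit.MatrixMultiplication.MatrixMultiplication.Theorems.GapTwoSixExplicit

-- single-conjunct summit: the `Summit.<S>.<P>` prefix repeats `MatrixMultiplication` by design (D-0017)
set_option linter.dupNamespace false

open scoped BigOperators ComplexConjugate InnerProductSpace
open Literature.Computability.AlgebraicComplexity Module

/-! ## The transpose symmetry: `F ↦ F^σ` swaps the `(210)` and `(120)` tests -/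

/-- `swapTr` is an involution. [folklore] -/
@[simp] theorem swapTr_swapTr (p : P2 × P2) : swapTr (swapTr p) = p := by
  simp [swapTr]

/-- Coordinates of `swapTr`. [folklore] -/
theorem swapTr_apply (k m : P2) : swapTr (k, m) = (m.swap, k.swap) := rfl

/-- `T = ⟨2,2,2⟩` is invariant under the transpose symmetry:
`T c (σ p).1 (σ p).2 = T cᵀ p.1 p.2`. [folklore] -/
theorem T2_swapTr (c : P2) (p : P2 × P2) : T2 c (swapTr p).1 (swapTr p).2 = T2 c.swap p.1 p.2 := by
  obtain ⟨⟨k1, k2⟩, ⟨m1, m2⟩⟩ := p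
  obtain ⟨c1, c2⟩ := c
  simp only [T2_apply, swapTr_apply, Prod.swap_prod_mk]
  congr 1
  exact propext ⟨fun ⟨a, b, c⟩ => ⟨c, b.symm, a⟩, fun ⟨a, b, c⟩ => ⟨c, b.symm, a⟩⟩

/-- The transported space `F^σ = {f ∘ σ : f ∈ F}` of bilinear forms. -/
abbrev sigmaF (F : Submodule ℂ (P2 × P2 → ℂ)) : Submodule ℂ (P2 × P2 → ℂ) :=
  F.map (LinearEquiv.funCongrLeft ℂ ℂ swapTr).toLinearMap

/-- `dim F^σ = dim F`. [folklore] -/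
theorem finrank_sigmaF (F : Submodule ℂ (P2 × P2 → ℂ)) : finrank ℂ (sigmaF F) = finrank ℂ F :=
  LinearEquiv.finrank_map_eq _ _

/-- Membership in `F^σ`. [folklore] -/
theorem mem_sigmaF_iff {F : Submodule ℂ (P2 × P2 → ℂ)} {g : P2 × P2 → ℂ} :
    g ∈ sigmaF F ↔ (fun p => g (swapTr p)) ∈ F := by
  constructor
  · rintro ⟨f, hf, rfl⟩
    have : (fun p => (LinearEquiv.funCongrLeft ℂ ℂ swapTr).toLinearMap f (swapTr p)) = f := by
      funext p
      simp [LinearEquiv.funCongrLeft_apply, LinearMap.funLeft_apply]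
    rw [this]; exact hf
  · intro h
    refine ⟨_, h, ?_⟩
    funext p
    simp [LinearEquiv.funCongrLeft_apply, LinearMap.funLeft_apply]

/-- `f ∘ σ ∈ F^σ` for `f ∈ F`. [folklore] -/
theorem comp_swapTr_mem_sigmaF {F : Submodule ℂ (P2 × P2 → ℂ)} {f : P2 × P2 → ℂ} (hf : f ∈ F) :
    (fun p => f (swapTr p)) ∈ sigmaF F := by
  rw [mem_sigmaF_iff]
  simpa using hf

/-- The dual basis vector `e_x` composed with the swap is `e_{xᵀ}`. [folklore] -/
theorem single_comp_swap (x : P2) :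
    (fun y : P2 => (Pi.single x (1 : ℂ) : P2 → ℂ) y.swap) = Pi.single x.swap 1 := by
  funext y
  by_cases h : y = x.swap
  · subst h; simp
  · have h' : y.swap ≠ x := fun h'' => h (by rw [← h'']; simp)
    simp [h, h']

/-- The `(210)`-products of `f ∘ σ` are the `(120)`-products of `f`, re-indexed by `arrTr`.
[folklore] -/
theorem mulA_comp_swapTr (f : P2 × P2 → ℂ) (α : P2 → ℂ) :
    TensorApolarity.mulA (fun p => f (swapTr p)) α
      = fun q => TensorApolarity.mulB f (fun y => α y.swap) (arrTr q) := by
  funext q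
  obtain ⟨k, k', m⟩ := q
  simp [TensorApolarity.mulA, TensorApolarity.mulB, arrTr, swapTr]

/-- **`F^σ·A*` is `F·B*` re-indexed by `arrTr`.** [folklore] -/
theorem prodA_sigmaF (F : Submodule ℂ (P2 × P2 → ℂ)) :
    TensorApolarity.prodA (sigmaF F)
      = (TensorApolarity.prodB F).map (LinearEquiv.funCongrLeft ℂ ℂ arrTr).toLinearMap := by
  apply le_antisymm
  · rw [TensorApolarity.prodA_le_iff]
    intro g hg x
    rw [mem_sigmaF_iff] at hg
    set f : P2 × P2 → ℂ := fun p' => g (swapTr p') with hf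
    have key : TensorApolarity.mulA g (Pi.single x 1)
        = TensorApolarity.mulA (fun p => f (swapTr p)) (Pi.single x 1) := by
      congr 1
    rw [key, mulA_comp_swapTr, single_comp_swap]
    exact ⟨_, TensorApolarity.mulB_single_mem_prodB hg x.swap, rfl⟩
  · rw [Submodule.map_le_iff_le_comap, TensorApolarity.prodB_le_iff]
    intro f hf y
    rw [Submodule.mem_comap]
    have h1 : (LinearEquiv.funCongrLeft ℂ ℂ arrTr).toLinearMap (TensorApolarity.mulB f (Pi.single y 1))
        = TensorApolarity.mulA (fun p => f (swapTr p)) (Pi.single y.swap 1) := by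
      rw [mulA_comp_swapTr, single_comp_swap, Prod.swap_swap]
      rfl
    rw [h1]
    exact TensorApolarity.mulA_single_mem_prodA (comp_swapTr_mem_sigmaF hf) _

/-- **`dim F^σ·A* = dim F·B*`.** [folklore] -/
theorem finrank_prodA_sigmaF (F : Submodule ℂ (P2 × P2 → ℂ)) :
    finrank ℂ (TensorApolarity.prodA (sigmaF F)) = finrank ℂ (TensorApolarity.prodB F) := by
  rw [prodA_sigmaF]
  exact LinearEquiv.finrank_map_eq _ _

/-- The slice pairings of `f ∘ σ` are those of `f` with transposed output index. [folklore] -/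
theorem slicePairing_comp_swapTr (f : P2 × P2 → ℂ) (c : P2) :
    (∑ p : P2 × P2, f (swapTr p) * T2 c p.1 p.2) = ∑ p : P2 × P2, f p * T2 c.swap p.1 p.2 := by
  rw [← Equiv.sum_comp swapTr (fun p => f (swapTr p) * T2 c p.1 p.2)]
  refine Finset.sum_congr rfl fun p _ => ?_
  rw [swapTr_swapTr, T2_swapTr]

/-- **Slice defect is invariant under the symmetry.** [folklore] -/
theorem defect_comp_swapTr (f : P2 × P2 → ℂ) :
    (∑ c : P2, ‖∑ p : P2 × P2, f (swapTr p) * T2 c p.1 p.2‖ ^ 2)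
      = ∑ c : P2, ‖∑ p : P2 × P2, f p * T2 c p.1 p.2‖ ^ 2 := by
  simp_rw [slicePairing_comp_swapTr]
  exact Equiv.sum_comp (Equiv.prodComm (Fin 2) (Fin 2)) (fun c => ‖∑ p : P2 × P2, f p * T2 c p.1 p.2‖ ^ 2)

/-- Square norms are invariant under the symmetry. [folklore] -/
theorem sum_norm_sq_comp_swapTr (f : P2 × P2 → ℂ) :
    (∑ p : P2 × P2, ‖f (swapTr p)‖ ^ 2) = ∑ p : P2 × P2, ‖f p‖ ^ 2 :=
  Equiv.sum_comp swapTr (fun p => ‖f p‖ ^ 2)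

/-- The slice-defect hypothesis transports to `F^σ`. [folklore] -/
theorem defect_sigmaF {F : Submodule ℂ (P2 × P2 → ℂ)} {θ : ℝ}
    (hθ : ∀ f ∈ F, (∑ c : P2, ‖∑ p : P2 × P2, f p * T2 c p.1 p.2‖ ^ 2) ≤ θ * ∑ p, ‖f p‖ ^ 2) :
    ∀ g ∈ sigmaF F, (∑ c : P2, ‖∑ p : P2 × P2, g p * T2 c p.1 p.2‖ ^ 2) ≤ θ * ∑ p, ‖g p‖ ^ 2 := by
  intro g hg
  rw [mem_sigmaF_iff] at hg
  have h := hθ _ hg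
  rw [defect_comp_swapTr, sum_norm_sq_comp_swapTr] at h
  exact h

/-! ## The symmetry on `V16` -/

/-- The symmetry `ℓ ↦ ℓ ∘ σ` as a linear map of `V16`. -/
abbrev sigmaV : V16 →ₗ[ℂ] V16 :=
  (WithLp.linearEquiv 2 ℂ (P2 × P2 → ℂ)).symm.toLinearMap ∘ₗ
    (LinearEquiv.funCongrLeft ℂ ℂ swapTr).toLinearMap ∘ₗ
      (WithLp.linearEquiv 2 ℂ (P2 × P2 → ℂ)).toLinearMap

/-- Coordinates of `sigmaV`. [folklore] -/
@[simp] theorem sigmaV_apply (ℓ : V16) (p : P2 × P2) : sigmaV ℓ p = ℓ (swapTr p) := rfl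

/-- `sigmaV` is an involution. [folklore] -/
theorem sigmaV_sigmaV (ℓ : V16) : sigmaV (sigmaV ℓ) = ℓ := by
  apply PiLp.ext; intro p
  simp

/-- `sigmaV` preserves inner products. [folklore] -/
theorem inner_sigmaV_sigmaV (x y : V16) : ⟪sigmaV x, sigmaV y⟫_ℂ = ⟪x, y⟫_ℂ := by
  simp only [PiLp.inner_apply, sigmaV_apply]
  exact Equiv.sum_comp swapTr (fun p => ⟪x p, y p⟫_ℂ)

/-- `sigmaV` is self-adjoint (an involutive isometry). [folklore] -/
theorem inner_sigmaV_left (x y : V16) : ⟪sigmaV x, y⟫_ℂ = ⟪x, sigmaV y⟫_ℂ := by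
  conv_lhs => rw [← sigmaV_sigmaV y]
  rw [inner_sigmaV_sigmaV]

/-- `sigmaV` is an isometry. [folklore] -/
theorem norm_sigmaV (ℓ : V16) : ‖sigmaV ℓ‖ = ‖ℓ‖ := by
  have h : ‖sigmaV ℓ‖ ^ 2 = ‖ℓ‖ ^ 2 := by
    rw [EuclideanSpace.norm_sq_eq, EuclideanSpace.norm_sq_eq]
    simp only [sigmaV_apply]
    exact Equiv.sum_comp swapTr (fun p => ‖ℓ p‖ ^ 2)
  exact (pow_left_inj₀ (norm_nonneg _) (norm_nonneg _) two_ne_zero).1 h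

/-- `annT` is invariant under the symmetry. [folklore] -/
theorem sigmaV_mem_annT {ℓ : V16} (hℓ : ℓ ∈ annT) : sigmaV ℓ ∈ annT := by
  intro c
  have h := hℓ c.swap
  simp only [sigmaV_apply]
  rw [slicePairing_comp_swapTr]
  exact h

/-- `perpTo` transports along the symmetry. [folklore] -/
theorem sigmaV_mem_perpTo {F : Submodule ℂ (P2 × P2 → ℂ)} {ℓ : V16} (hℓ : ℓ ∈ perpTo F) :
    sigmaV ℓ ∈ perpTo (sigmaF F) := by
  intro g hg
  rw [mem_sigmaF_iff] at hg
  have h := hℓ _ hg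
  simp only [sigmaV_apply]
  rw [← Equiv.sum_comp swapTr (fun p => conj (ℓ (swapTr p)) * g p)]
  simpa using h

/-- `⟪u_i ⊗ h, ℓ⟫ = ⟪h, hComp i ℓ⟫`. [folklore] -/
theorem inner_uTensor (i : Fin 2) (h : V8) (ℓ : V16) : ⟪uTensor i h, ℓ⟫_ℂ = ⟪h, hComp i ℓ⟫_ℂ := by
  rw [PiLp.inner_apply, PiLp.inner_apply, Fintype.sum_prod_type, Fintype.sum_prod_type,
    Fin.sum_univ_two]
  have hz : ∀ (j : Fin 2) (m : P2), ⟪uTensor i h ((1 - i, j), m), ℓ ((1 - i, j), m)⟫_ℂ = 0 := by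
    intro j m
    have : ¬ ((1 : Fin 2) - i = i) := by fin_cases i <;> decide
    simp [uTensor, this]
  have hi : ∀ (j : Fin 2) (m : P2), ⟪uTensor i h ((i, j), m), ℓ ((i, j), m)⟫_ℂ = ⟪h (j, m), hComp i ℓ (j, m)⟫_ℂ := by
    intro j m
    simp [uTensor, hComp]
  fin_cases i
  · simp only [Fin.isValue, Fin.zero_eta] at hi hz ⊢
    have hz' : ∀ (j : Fin 2) (m : P2), ⟪uTensor 0 h ((1, j), m), ℓ ((1, j), m)⟫_ℂ = 0 := hz
    simp only [hi, hz', Finset.sum_const_zero, add_zero, Fintype.sum_prod_type]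
  · simp only [Fin.isValue, Fin.mk_one] at hi hz ⊢
    have hz' : ∀ (j : Fin 2) (m : P2), ⟪uTensor 1 h ((0, j), m), ℓ ((0, j), m)⟫_ℂ = 0 := hz
    simp only [hi, hz', Finset.sum_const_zero, zero_add, Fintype.sum_prod_type]

end Summit.MatrixMultiplication.MatrixMultiplication.Theorems.GapTwoSixExplicit

end
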